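import Summits.CriticalPhenomena.PercolationContinuityZ3.Theorems.Transplant.HexShadowSurgeryAtt
import Summits.CriticalPhenomena.PercolationContinuityZ3.Theorems.Transplant.HexShadowFact1
import HarnessLib

/-!
# HEXAGONAL SHADOWS XXVIII — Fact 2 of DST §2.3 in hexagonal geometry: the output of a recoverable LOCATED surgery (`SurgOut`), separated families of points
# of `𝕋`, and the surgery of the core files as such an output

builds on p205010 (kernel theorem, internal audit signed; external expert review pending) — NOT used in this file.  Lane `prim-bschramm`, seat
`prim-bschramm-p2` (gen 32; class C1b; memo §118); helper file (`--supports stmt-CriticalPhenomena-4575 --as helper`).  Slab original: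
`Literature/…/SlabGluingFact2Reduction` §"SurgOutDef" and `SlabGluingFact2` (`exists_separated_subset`, `mem_sqBox_six_of_three`, `mem_window_of_mem_newConfig`),
with sup-norm boxes replaced by lattice hexagons.
* §1 counting in `𝕋`: a lattice hexagon of radius `R` has at most `(2R+1)²` points (`card_filter_mem_hexBall_le`), the GREEDY SEPARATED SUBFAMILY
  (`exists_separated_subset_hex`: `|A| ≤ (2R+1)²·|Sel|`, points of `Sel` pairwise at `triNorm`-distance `> R`), `mem_hexBall_six_of_three`,
  `hexBall_subset_hexBall_add_three`;
* §2 **`HexShadow.SurgOut Γ r ω z ω'`** — the properties of DST's `ω^{(z)}` that the Lemma-7 bookkeeping consumes: `ω' ∈ C`; `ω' ⊆ ω ∪ (E(G) ∩ window pairs)`;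
  `ω'` agrees with `ω` off the pairs touching `\overline{hexBall z r}`; `Att(ω') ≠ ∅` and `Att(ω') ⊆ \overline{hexBall z 3}`.  **`Surgery.surgOut`**: the surgery of
  «HexShadowSurgeryData/Exchange/Att» with cleared columns `D ⊆ hexBall z 3` IS such an output (radius `3`).
[cite: DuminilCopinSidoraviciusTassion2016, §2.3 (proof of Fact 2, pp. 6–7)]
-/

noncomputable section

namespace Summit.CriticalPhenomena.PercolationContinuityZ3.Theorems.Transplant

open MeasureTheory Literature.Probability.Percolation Literature.Probability.LatticeModels SimpleGraph Filter
open scoped Classical Topology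

/-! ## §1 Counting and separating in `𝕋` -/

/-- The triangle inequality for `triNorm`, distance form (private copy). [folklore] -/
private theorem triNorm_sub_le₂₈ (u v w : Site 2) : triNorm (u - w) ≤ triNorm (u - v) + triNorm (v - w) := by
  simp only [triNorm, Pi.sub_apply, max_le_iff]
  have l0 := (abs_le_triNorm (u - v)).1; have l1 := (abs_le_triNorm (u - v)).2
  have l2 : |(u - v) 0 + (u - v) 1| ≤ triNorm (u - v) := (le_max_right _ _).trans (le_max_right _ _)
  have m0 := (abs_le_triNorm (v - w)).1; have m1 := (abs_le_triNorm (v - w)).2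
  have m2 : |(v - w) 0 + (v - w) 1| ≤ triNorm (v - w) := (le_max_right _ _).trans (le_max_right _ _)
  simp only [triNorm, Pi.sub_apply] at l0 l1 l2 m0 m1 m2 ⊢
  rw [abs_le] at l0 l1 l2 m0 m1 m2
  refine ⟨abs_le.2 ⟨?_, ?_⟩, abs_le.2 ⟨?_, ?_⟩, abs_le.2 ⟨?_, ?_⟩⟩ <;> linarith

/-- `triNorm`-distance is symmetric (private copy; the tree's lives in a heavy arm-event file). [folklore] -/
private theorem triNorm_sub_comm₂₈ (a b : Site 2) : triNorm (a - b) = triNorm (b - a) := by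
  rw [show a - b = -(b - a) by abel]; simp only [triNorm, Pi.neg_apply, ← neg_add, abs_neg]

/-- Membership in lattice hexagons is symmetric. [folklore] -/
theorem mem_hexBall_comm {z w : Site 2} {R : ℕ} : w ∈ hexBall z R ↔ z ∈ hexBall w R := by
  rw [mem_hexBall, mem_hexBall, triNorm_sub_comm₂₈]

/-- **A lattice hexagon of radius `R` has at most `(2R+1)²` points** (it lies in the sup-norm box). [folklore] -/
theorem card_filter_mem_hexBall_le (A : Finset (Site 2)) (z : Site 2) (R : ℕ) [DecidablePred (· ∈ hexBall z R)] :
    (A.filter (· ∈ hexBall z R)).card ≤ (2 * R + 1) ^ 2 := by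
  set f : Site 2 → ℤ × ℤ := fun w => (w 0, w 1) with hf
  have hinj : Set.InjOn f ↑(A.filter (· ∈ hexBall z R)) := by
    intro a _ b _ h
    simp only [hf, Prod.mk.injEq] at h
    exact Site.eq_iff_two.2 h
  have hmaps : ∀ w ∈ A.filter (· ∈ hexBall z R), f w ∈ (Finset.Icc (z 0 - R) (z 0 + R)) ×ˢ (Finset.Icc (z 1 - R) (z 1 + R)) := by
    intro w hw
    obtain ⟨-, hw⟩ := Finset.mem_filter.1 hw
    rw [mem_hexBall] at hw
    have h0 := (abs_le_triNorm (w - z)).1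
    have h1 := (abs_le_triNorm (w - z)).2
    rw [Pi.sub_apply, abs_le] at h0 h1
    simp only [hf, Finset.mem_product, Finset.mem_Icc]
    omega
  refine (Finset.card_le_card_of_injOn f hmaps hinj).trans ?_
  rw [Finset.card_product, Int.card_Icc, Int.card_Icc]
  have e0 : (z 0 + R + 1 - (z 0 - R)).toNat = 2 * R + 1 := by omega
  have e1 : (z 1 + R + 1 - (z 1 - R)).toNat = 2 * R + 1 := by omega
  rw [e0, e1]; ring_nf; rfl

/-- The number of points of a lattice hexagon. [folklore] -/
theorem card_toFinset_hexBall_le (z : Site 2) (R : ℕ) : (hexBall_finite z R).toFinset.card ≤ (2 * R + 1) ^ 2 := by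
  classical
  have : (hexBall_finite z R).toFinset = (hexBall_finite z R).toFinset.filter (· ∈ hexBall z R) := by ext w; simp
  rw [this]
  exact card_filter_mem_hexBall_le _ z R

/-- **Greedy separated subfamily**: a finite set `A ⊆ 𝕋` contains a subset `Sel`, any two distinct points of which are at `triNorm`-distance `> R`, with
`|A| ≤ (2R+1)² |Sel|`. [folklore] -/
theorem exists_separated_subset_hex (R : ℕ) : ∀ (A : Finset (Site 2)), ∃ Sel : Finset (Site 2), Sel ⊆ A ∧
    (∀ z ∈ Sel, ∀ z' ∈ Sel, z ≠ z' → z' ∉ hexBall z R) ∧ A.card ≤ (2 * R + 1) ^ 2 * Sel.card := by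
  classical
  intro A
  induction A using Finset.strongInduction with
  | H A ih =>
    rcases A.eq_empty_or_nonempty with rfl | ⟨z, hz⟩
    · exact ⟨∅, Finset.empty_subset _, by simp, by simp⟩
    · set A' := A.filter (· ∉ hexBall z R) with hA'
      have hzz : z ∈ hexBall z R := by simp [mem_hexBall]
      have hA'A : A' ⊂ A := by
        refine Finset.ssubset_iff_subset_ne.2 ⟨Finset.filter_subset _ _, fun h => ?_⟩
        have : z ∈ A' := by rw [h]; exact hz
        exact (Finset.mem_filter.1 this).2 hzz
      obtain ⟨Sel', hSel'A', hsep', hcard'⟩ := ih A' hA'A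
      have hzSel' : z ∉ Sel' := fun h => (Finset.mem_filter.1 (hSel'A' h)).2 hzz
      refine ⟨insert z Sel', ?_, ?_, ?_⟩
      · exact Finset.insert_subset hz (hSel'A'.trans (Finset.filter_subset _ _))
      · intro w hw w' hw' hne
        rw [Finset.mem_insert] at hw hw'
        rcases hw with rfl | hw <;> rcases hw' with rfl | hw'
        · exact absurd rfl hne
        · exact (Finset.mem_filter.1 (hSel'A' hw')).2
        · intro hmem
          exact (Finset.mem_filter.1 (hSel'A' hw)).2 (mem_hexBall_comm.1 hmem)
        · exact hsep' w hw w' hw' hne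
      · have hsplit : A.card ≤ (A.filter (· ∈ hexBall z R)).card + A'.card := by
          rw [hA', Finset.card_filter_add_card_filter_not]
        have hbox := card_filter_mem_hexBall_le A z R
        rw [Finset.card_insert_of_notMem hzSel']
        nlinarith

/-- Two points at `triNorm`-distance `≤ 3` from a common point are at distance `≤ 6`. [folklore] -/
theorem mem_hexBall_six_of_three {z z' q : Site 2} (hq : q ∈ hexBall z 3) (hq' : q ∈ hexBall z' 3) : z' ∈ hexBall z 6 := by
  rw [mem_hexBall] at hq hq' ⊢
  have := triNorm_sub_le₂₈ z' q z
  rw [triNorm_sub_comm₂₈ q z'] at hq'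
  push_cast at hq hq' ⊢; omega

/-- A hexagon of radius `r` about `z` lies in the hexagon of radius `r + 3` about any point of `hexBall z 3`. [folklore] -/
theorem hexBall_subset_hexBall_add_three {z q : Site 2} (hq : q ∈ hexBall z 3) (r : ℕ) : hexBall z r ⊆ hexBall q (r + 3) := by
  intro w hw
  rw [mem_hexBall] at hq hw ⊢
  have := triNorm_sub_le₂₈ w z q
  rw [triNorm_sub_comm₂₈ q z] at hq
  push_cast at hw ⊢; omega

namespace HexShadow

variable {V : Type} {G : SimpleGraph V} (Φ : HexShadow G) [Countable V]

omit [Countable V] in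
/-- `touch` is monotone in the set of columns. [folklore] -/
theorem touch_mono {D D' : Set (Site 2)} (h : D ⊆ D') : Φ.touch D ⊆ Φ.touch D' := by
  rintro e ⟨x, hx, hxD⟩
  exact ⟨x, hx, h hxD⟩

/-! ## §2 Located surgery outputs -/

/-- **The output of one recoverable local surgery of `ω` located at `z ∈ 𝕋`** (what the proof of Fact 2 uses of DST's `ω^{(z)}`): `ω' ∈ C`; `ω'` consists of
edges of `ω` and lattice edges over the window; `ω'` agrees with `ω` off the pairs touching `\overline{hexBall z r}`; `Att(ω') ≠ ∅` lies over `hexBall z 3`.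
[cite: DuminilCopinSidoraviciusTassion2016, §2.3, proof of Fact 2 (pp. 6–7)] -/
structure SurgOut (Γ : GlueData) (r : ℕ) (ω : BondConfig V) (z : Site 2) (ω' : BondConfig V) : Prop where
  /-- the new configuration realises `C` -/
  mem_evC : ω' ∈ Φ.evC Γ
  /-- it consists of old edges and lattice edges of the window -/
  subset_window : ω' ⊆ ω ∪ (G.edgeSet ∩ (Φ.lift (Φ.big Γ ∪ Φ.small Γ)).sym2)
  /-- it agrees with `ω` off the pairs touching `\overline{hexBall z r}` -/
  agree_off : ∀ e, e ∉ Φ.touch (hexBall z r) → (e ∈ ω' ↔ e ∈ ω)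
  /-- the attachment statistic is non-empty -/
  att_nonempty : (Φ.att Γ ω').Nonempty
  /-- and lies over `hexBall z 3` -/
  att_near : ∀ q ∈ Φ.att Γ ω', Φ.sh q ∈ hexBall z 3

/-- Enlarging the radius. [folklore] -/
theorem SurgOut.mono {Γ : GlueData} {r r' : ℕ} (hr : r ≤ r') {ω ω' : BondConfig V} {z : Site 2} (h : Φ.SurgOut Γ r ω z ω') : Φ.SurgOut Γ r' ω z ω' where
  mem_evC := h.mem_evC
  subset_window := h.subset_window
  agree_off := fun e he => h.agree_off e fun he' => he (Φ.touch_mono (hexBall_mono z hr) he')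
  att_nonempty := h.att_nonempty
  att_near := h.att_near

variable {Φ}

/-- The new configuration of a surgery consists of old edges and of lattice edges over the window. [folklore] -/
theorem Surgery.mem_window_of_mem_newConfig {Γ : GlueData} {ω : BondConfig V} (sg : Φ.Surgery Γ ω) (hA : ω ∈ Φ.evA Γ) {e : Sym2 V}
    (he : e ∈ sg.newConfig) : e ∈ ω ∨ (e ∈ G.edgeSet ∧ e ∈ (Φ.lift (Φ.big Γ ∪ Φ.small Γ)).sym2) := by
  rcases sg.newConfig_subset hA he with h | h
  · exact Or.inl h
  · right
    refine ⟨?_, ?_⟩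
    · rcases h with h | h
      · exact edgesOf_subset_edgeSet sg.hSPchain h
      · exact edgesOf_subset_edgeSet sg.hBrchain h
    · induction e using Sym2.ind with
      | h a b =>
        obtain ⟨ha, hb⟩ := sg.structEdges_Sw h
        exact Set.mk_mem_sym2_iff.2 ⟨sg.hD (sg.Sw_D ha), sg.hD (sg.Sw_D hb)⟩

/-- **The surgery of the core files is a recoverable located surgery**: for `ω ∈ 𝒳` and data with cleared columns `D ⊆ hexBall z 3`, `ω^{(z)}` is an output
located at `z` with radius `3`. [cite: DuminilCopinSidoraviciusTassion2016, §2.3, proof of Fact 2 (pp. 6–7)] -/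
theorem Surgery.surgOut {Γ : GlueData} {ω : BondConfig V} (sg : Φ.Surgery Γ ω) (hX : ω ∈ Φ.evX Γ) {z : Site 2} (hD : sg.D ⊆ hexBall z 3) :
    Φ.SurgOut Γ 3 ω z sg.newConfig where
  mem_evC := sg.newConfig_mem_evC hX
  subset_window := fun e he => by
    rcases sg.mem_window_of_mem_newConfig hX.1.1.1 he with h | ⟨h1, h2⟩
    · exact Or.inl h
    · exact Or.inr ⟨h1, h2⟩
  agree_off := fun e he => sg.mem_newConfig_iff_of_not_touch fun h => he (Φ.touch_mono hD h)
  att_nonempty := sg.att_nonempty hX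
  att_near := fun q hq => by
    have := sg.att_subset hX hq
    rw [mem_lift] at this
    exact hD this

end HexShadow

end Summit.CriticalPhenomena.PercolationContinuityZ3.Theorems.Transplant

end
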